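import Literature.MathematicalPhysics.KineticTheory.InfiniteChainGibbsMomentaIndependence
import Literature.MathematicalPhysics.KineticTheory.InfiniteChainObservables
import HarnessLib

/-!
# The static current variance of a shift-invariant DLR state of the oscillator chain

Topic `Literature/MathematicalPhysics/KineticTheory`; theorems only (no definitions, no named
facts). Sequel of `InfiniteChainGibbsMomentaIndependence.lean` (each momentum is `N(0,T)` and
independent of the position field under a DLR state), `InfiniteChainPartialMomentumReversal.lean`
(`∑_x ∫ j_0 j_x dμ` is the three-term sum `x = -1, 0, 1`) and `InfiniteChainObservables.lean`
(shift covariance `bondCurrentZ_shift`), for the Green–Kubo objects of `InfiniteChainDynamics.lean`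
(`j_x = -½ (p_x + p_{x+1}) V'(q_{x+1} - q_x)`, `currentCorrelation D μ t = ∑_x ∫ j_0 (j_x ∘ φ_t) dμ`).

For a nearest-neighbour chain `P : OscillatorChain` with continuous `U`, `V`, `T > 0` and a DLR
state `μ` at `T`:
* `IsChainGibbsMeasure.integral_add_sq_mul`, `IsChainGibbsMeasure.integral_add_mul_add_mul` — the
  Gaussian moments `∫ (p_i + p_j)² g(q) dμ = 2T ∫ g(q) dμ` (`i ≠ j`) and
  `∫ (p_i + p_j)(p_j + p_k) g(q) dμ = T ∫ g(q) dμ` (`i, j, k` distinct), given integrability of the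
  finitely many moments involved;
* `IsChainGibbsMeasure.tsum_integral_bondCurrentZ_mul_eq` — **for shift-invariant `μ`, the static
  summed current covariance is a variance**:
  `∑_x ∫ j_0 j_x dμ = (T/4) ∫ (V'(q_1 - q_0) + V'(q_2 - q_1))² dμ`
  (`∫ j_0² = (T/2) ∫ V'(r_0)²`, `∫ j_0 j_{±1} = (T/4) ∫ V'(r_0) V'(r_1)`, `∫ V'(r_1)² = ∫ V'(r_0)²`);
* `InfiniteChainDynamics.currentCorrelation_zero_eq_variance` — hence
  `C(0) = D.currentCorrelation μ 0 = (T/4) ∫ (V'(r_0) + V'(r_1))² dμ ≥ 0` for every dynamics `D`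
  preserving `μ`.

Strict positivity for the pinned anharmonic chain (`V'` odd and injective, so the integrand
vanishes only on the one-site null event `{q_0 = q_2}`) is drawn in the summit-side file that needs
it. Everything is proved; standard computations, tagged `[folklore]`.
-/

noncomputable section

open MeasureTheory ProbabilityTheory Filter Set Function Literature.Probability.LatticeModels
open scoped ENNReal NNReal

namespace Literature.MathematicalPhysics.KineticTheory.HeatConduction

namespace OscillatorChain

variable {P : OscillatorChain}

/-! ### Gaussian moments behind the current covariances -/

/-- `∫ (p_i + p_j)² g(q) dμ = 2T ∫ g(q) dμ` for `i ≠ j` (expand; equipartition on the squares, the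
mixed term is odd), given integrability of the three moments. [folklore] -/
theorem IsChainGibbsMeasure.integral_add_sq_mul (hU : Continuous P.U) (hV : Continuous P.V)
    {T : ℝ} (hT : 0 < T) {μ : Measure ChainConfig} (hμ : P.IsChainGibbsMeasure T μ) {i j : ℤ}
    (hij : i ≠ j) {g : (ℤ → ℝ) → ℝ} (hg : Measurable g)
    (hii : Integrable (fun σ : ChainConfig => (σ i).2 * (σ i).2 * g (fun x => (σ x).1)) μ)
    (hij' : Integrable (fun σ : ChainConfig => (σ i).2 * (σ j).2 * g (fun x => (σ x).1)) μ)
    (hjj : Integrable (fun σ : ChainConfig => (σ j).2 * (σ j).2 * g (fun x => (σ x).1)) μ) :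
    ∫ σ, ((σ i).2 + (σ j).2) ^ 2 * g (fun x => (σ x).1) ∂μ =
      2 * T * ∫ σ, g (fun x => (σ x).1) ∂μ := by
  have e : ∀ σ : ChainConfig, ((σ i).2 + (σ j).2) ^ 2 * g (fun x => (σ x).1) =
      (σ i).2 * (σ i).2 * g (fun x => (σ x).1) + (σ i).2 * (σ j).2 * g (fun x => (σ x).1) +
        ((σ i).2 * (σ j).2 * g (fun x => (σ x).1) + (σ j).2 * (σ j).2 * g (fun x => (σ x).1)) := by
    intro σ; ring
  simp_rw [e]
  rw [integral_add ?_ ?_, integral_add hii hij', integral_add hij' hjj,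
    hμ.integral_snd_mul_snd_mul hU hV hT i hg, hμ.integral_snd_mul_snd_mul hU hV hT j hg,
    hμ.integral_snd_mul_snd_mul_eq_zero hij g]
  · ring
  · exact hii.add hij'
  · exact hij'.add hjj

/-- `∫ (p_i + p_j)(p_j + p_k) g(q) dμ = T ∫ g(q) dμ` for pairwise distinct `i, j, k` (only `p_j²`
survives), given integrability of the four moments. [folklore] -/
theorem IsChainGibbsMeasure.integral_add_mul_add_mul (hU : Continuous P.U) (hV : Continuous P.V)
    {T : ℝ} (hT : 0 < T) {μ : Measure ChainConfig} (hμ : P.IsChainGibbsMeasure T μ) {i j k : ℤ}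
    (hij : i ≠ j) (hik : i ≠ k) (hjk : j ≠ k) {g : (ℤ → ℝ) → ℝ} (hg : Measurable g)
    (hij' : Integrable (fun σ : ChainConfig => (σ i).2 * (σ j).2 * g (fun x => (σ x).1)) μ)
    (hik' : Integrable (fun σ : ChainConfig => (σ i).2 * (σ k).2 * g (fun x => (σ x).1)) μ)
    (hjj : Integrable (fun σ : ChainConfig => (σ j).2 * (σ j).2 * g (fun x => (σ x).1)) μ)
    (hjk' : Integrable (fun σ : ChainConfig => (σ j).2 * (σ k).2 * g (fun x => (σ x).1)) μ) :
    ∫ σ, ((σ i).2 + (σ j).2) * ((σ j).2 + (σ k).2) * g (fun x => (σ x).1) ∂μ =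
      T * ∫ σ, g (fun x => (σ x).1) ∂μ := by
  have e : ∀ σ : ChainConfig, ((σ i).2 + (σ j).2) * ((σ j).2 + (σ k).2) * g (fun x => (σ x).1) =
      (σ i).2 * (σ j).2 * g (fun x => (σ x).1) + (σ i).2 * (σ k).2 * g (fun x => (σ x).1) +
        ((σ j).2 * (σ j).2 * g (fun x => (σ x).1) + (σ j).2 * (σ k).2 * g (fun x => (σ x).1)) := by
    intro σ; ring
  simp_rw [e]
  rw [integral_add ?_ ?_, integral_add hij' hik', integral_add hjj hjk',
    hμ.integral_snd_mul_snd_mul hU hV hT j hg, hμ.integral_snd_mul_snd_mul_eq_zero hij g,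
    hμ.integral_snd_mul_snd_mul_eq_zero hik g, hμ.integral_snd_mul_snd_mul_eq_zero hjk g]
  · ring
  · exact hij'.add hik'
  · exact hjj.add hjk'

/-! ### The static current variance of a shift-invariant DLR state -/

/-- **Static current variance of a shift-invariant DLR state.** For continuous `U`, `V`, `T > 0`,
a shift-invariant DLR state `μ` at `T` under which the moments `p_i p_j V'(r_0)²` (`i, j ∈ {0,1}`),
`p_i p_j V'(r_0)V'(r_1)` (`i, j ∈ {0,1,2}`), `V'(r_0)²` and `V'(r_0)V'(r_1)` are integrable
(`r_x = q_{x+1} - q_x`):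
`∑_x ∫ j_0 j_x dμ = (T/4) ∫ (V'(r_0) + V'(r_1))² dμ` — the sum has the three terms `x = -1, 0, 1`
(`tsum_integral_bondCurrentZ_mul`), `∫ j_0 j_{-1} = ∫ j_0 j_1` and `∫ V'(r_1)² = ∫ V'(r_0)²` by shift
invariance, `∫ j_0² = (T/2) ∫ V'(r_0)²` and `∫ j_0 j_1 = (T/4) ∫ V'(r_0)V'(r_1)` by the conditional
Gaussian structure of the momenta. [folklore] -/
theorem IsChainGibbsMeasure.tsum_integral_bondCurrentZ_mul_eq (hU : Continuous P.U)
    (hV : Continuous P.V) {T : ℝ} (hT : 0 < T) {μ : Measure ChainConfig}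
    (hμ : P.IsChainGibbsMeasure T μ) (hshift : IsShiftInvariant μ)
    (hI₀ : ∀ i j : ℤ, 0 ≤ i → i ≤ 1 → 0 ≤ j → j ≤ 1 → Integrable (fun σ : ChainConfig =>
      (σ i).2 * (σ j).2 * deriv P.V ((σ 1).1 - (σ 0).1) ^ 2) μ)
    (hI₁ : ∀ i j : ℤ, 0 ≤ i → i ≤ 2 → 0 ≤ j → j ≤ 2 → Integrable (fun σ : ChainConfig =>
      (σ i).2 * (σ j).2 * (deriv P.V ((σ 1).1 - (σ 0).1) * deriv P.V ((σ 2).1 - (σ 1).1))) μ)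
    (ha2 : Integrable (fun σ : ChainConfig => deriv P.V ((σ 1).1 - (σ 0).1) ^ 2) μ)
    (hab : Integrable (fun σ : ChainConfig =>
      deriv P.V ((σ 1).1 - (σ 0).1) * deriv P.V ((σ 2).1 - (σ 1).1)) μ) :
    ∑' x : ℤ, ∫ σ, P.bondCurrentZ σ 0 * P.bondCurrentZ σ x ∂μ =
      T / 4 * ∫ σ, (deriv P.V ((σ 1).1 - (σ 0).1) + deriv P.V ((σ 2).1 - (σ 1).1)) ^ 2 ∂μ := by
  rw [hμ.tsum_integral_bondCurrentZ_mul]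
  -- shift invariance: `∫ j_0 j_{-1} = ∫ j_0 j_1`, `∫ V'(r_1)² = ∫ V'(r_0)²`
  have hm1 : ∫ σ, P.bondCurrentZ σ 0 * P.bondCurrentZ σ (-1) ∂μ =
      ∫ σ, P.bondCurrentZ σ 0 * P.bondCurrentZ σ 1 ∂μ := by
    rw [← hshift.integral_comp_shift (fun σ => P.bondCurrentZ σ 0 * P.bondCurrentZ σ (-1))]
    simp only [bondCurrentZ_shift]
    norm_num
    exact integral_congr_ae (Eventually.of_forall fun σ => mul_comm _ _)
  have hb2 : ∫ σ, deriv P.V ((σ 2).1 - (σ 1).1) ^ 2 ∂μ = ∫ σ, deriv P.V ((σ 1).1 - (σ 0).1) ^ 2 ∂μ := by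
    rw [← hshift.integral_comp_shift (fun σ => deriv P.V ((σ 1).1 - (σ 0).1) ^ 2)]
    simp only [shift]
    norm_num
  have hb2i : Integrable (fun σ : ChainConfig => deriv P.V ((σ 2).1 - (σ 1).1) ^ 2) μ := by
    have h := (hshift.integrable_comp_shift_iff (fun σ => deriv P.V ((σ 1).1 - (σ 0).1) ^ 2)).2 ha2
    refine h.congr (Eventually.of_forall fun σ => ?_)
    simp only [Function.comp_apply, shift]
    norm_num
  -- the two covariances
  have hq : ∀ x : ℤ, Measurable fun q : ℤ → ℝ => q x := fun x => measurable_pi_apply x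
  have hg₀ : Measurable fun q : ℤ → ℝ => deriv P.V (q 1 - q 0) ^ 2 :=
    ((measurable_deriv P.V).comp ((hq 1).sub (hq 0))).pow_const 2
  have hg₁ : Measurable fun q : ℤ → ℝ => deriv P.V (q 1 - q 0) * deriv P.V (q 2 - q 1) :=
    ((measurable_deriv P.V).comp ((hq 1).sub (hq 0))).mul
      ((measurable_deriv P.V).comp ((hq 2).sub (hq 1)))
  have h00 : ∫ σ, P.bondCurrentZ σ 0 * P.bondCurrentZ σ 0 ∂μ =
      T / 2 * ∫ σ, deriv P.V ((σ 1).1 - (σ 0).1) ^ 2 ∂μ := by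
    have e : ∀ σ : ChainConfig, P.bondCurrentZ σ 0 * P.bondCurrentZ σ 0 =
        4⁻¹ * (((σ 0).2 + (σ 1).2) ^ 2 * deriv P.V ((σ 1).1 - (σ 0).1) ^ 2) := by
      intro σ
      simp only [bondCurrentZ, zero_add]
      ring
    simp_rw [e]
    rw [integral_const_mul, hμ.integral_add_sq_mul hU hV hT zero_ne_one hg₀
      (hI₀ 0 0 le_rfl zero_le_one le_rfl zero_le_one) (hI₀ 0 1 le_rfl zero_le_one zero_le_one le_rfl)
      (hI₀ 1 1 zero_le_one le_rfl zero_le_one le_rfl)]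
    ring
  have h01 : ∫ σ, P.bondCurrentZ σ 0 * P.bondCurrentZ σ 1 ∂μ =
      T / 4 * ∫ σ, deriv P.V ((σ 1).1 - (σ 0).1) * deriv P.V ((σ 2).1 - (σ 1).1) ∂μ := by
    have e : ∀ σ : ChainConfig, P.bondCurrentZ σ 0 * P.bondCurrentZ σ 1 =
        4⁻¹ * (((σ 0).2 + (σ 1).2) * ((σ 1).2 + (σ 2).2) *
          (deriv P.V ((σ 1).1 - (σ 0).1) * deriv P.V ((σ 2).1 - (σ 1).1))) := by
      intro σ
      simp only [bondCurrentZ, zero_add, one_add_one_eq_two]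
      ring
    simp_rw [e]
    rw [integral_const_mul, hμ.integral_add_mul_add_mul hU hV hT zero_ne_one (by norm_num)
      (by norm_num) hg₁
      (hI₁ 0 1 le_rfl (by norm_num) zero_le_one (by norm_num))
      (hI₁ 0 2 le_rfl (by norm_num) (by norm_num) le_rfl)
      (hI₁ 1 1 zero_le_one (by norm_num) zero_le_one (by norm_num))
      (hI₁ 1 2 zero_le_one (by norm_num) (by norm_num) le_rfl)]
    ring
  -- assemble
  have hsq : ∫ σ, (deriv P.V ((σ 1).1 - (σ 0).1) + deriv P.V ((σ 2).1 - (σ 1).1)) ^ 2 ∂μ =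
      2 * ∫ σ, deriv P.V ((σ 1).1 - (σ 0).1) ^ 2 ∂μ +
        2 * ∫ σ, deriv P.V ((σ 1).1 - (σ 0).1) * deriv P.V ((σ 2).1 - (σ 1).1) ∂μ := by
    have e : ∀ σ : ChainConfig,
        (deriv P.V ((σ 1).1 - (σ 0).1) + deriv P.V ((σ 2).1 - (σ 1).1)) ^ 2 =
        deriv P.V ((σ 1).1 - (σ 0).1) ^ 2 + deriv P.V ((σ 2).1 - (σ 1).1) ^ 2 +
          2 * (deriv P.V ((σ 1).1 - (σ 0).1) * deriv P.V ((σ 2).1 - (σ 1).1)) := by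
      intro σ; ring
    simp_rw [e]
    rw [integral_add ?_ (hab.const_mul 2), integral_add ha2 hb2i, integral_const_mul, hb2]
    · ring
    · exact ha2.add hb2i
  rw [hm1, h00, h01, hsq]
  ring

end OscillatorChain

/-- **`C(0)` of a preserved shift-invariant DLR state is a variance**:
`D.currentCorrelation μ 0 = (T/4) ∫ (V'(q_1 - q_0) + V'(q_2 - q_1))² dμ` for every dynamics `D`
preserving `μ` (`φ_0 = id` a.e.), under the hypotheses of
`IsChainGibbsMeasure.tsum_integral_bondCurrentZ_mul_eq`. [folklore] -/
theorem InfiniteChainDynamics.currentCorrelation_zero_eq_variance {P : OscillatorChain}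
    (D : InfiniteChainDynamics P) (hU : Continuous P.U) (hV : Continuous P.V) {T : ℝ} (hT : 0 < T)
    {μ : Measure ChainConfig} (hμ : P.IsChainGibbsMeasure T μ) (hshift : IsShiftInvariant μ)
    (hD : D.PreservesMeasure μ)
    (hI₀ : ∀ i j : ℤ, 0 ≤ i → i ≤ 1 → 0 ≤ j → j ≤ 1 → Integrable (fun σ : ChainConfig =>
      (σ i).2 * (σ j).2 * deriv P.V ((σ 1).1 - (σ 0).1) ^ 2) μ)
    (hI₁ : ∀ i j : ℤ, 0 ≤ i → i ≤ 2 → 0 ≤ j → j ≤ 2 → Integrable (fun σ : ChainConfig =>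
      (σ i).2 * (σ j).2 * (deriv P.V ((σ 1).1 - (σ 0).1) * deriv P.V ((σ 2).1 - (σ 1).1))) μ)
    (ha2 : Integrable (fun σ : ChainConfig => deriv P.V ((σ 1).1 - (σ 0).1) ^ 2) μ)
    (hab : Integrable (fun σ : ChainConfig =>
      deriv P.V ((σ 1).1 - (σ 0).1) * deriv P.V ((σ 2).1 - (σ 1).1)) μ) :
    D.currentCorrelation μ 0 =
      T / 4 * ∫ σ, (deriv P.V ((σ 1).1 - (σ 0).1) + deriv P.V ((σ 2).1 - (σ 1).1)) ^ 2 ∂μ := by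
  rw [← hμ.tsum_integral_bondCurrentZ_mul_eq hU hV hT hshift hI₀ hI₁ ha2 hab]
  unfold InfiniteChainDynamics.currentCorrelation
  exact tsum_congr fun x => integral_congr_ae (D.bondCurrentZ_mul_flow_zero_ae_eq hD x)

end Literature.MathematicalPhysics.KineticTheory.HeatConduction

end
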